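import Summits.KontsevichZagierPeriods.Zeta5Search.SymmetricGaugeLaw
import HarnessLib

/-!
# ζ(5) search — Brown–Zudilin's (29)–(30) PERMUTATION-GROUP SAVING as a standalone node (census g16's wording AND proofs)

Filed by the lead lane (lit g9, 2026-08-20) from census g16's scratch file `HOME/pub-zeta5-census/xsave/g16/bc/PermutationSaving.lean`
(sha256 4d31a58b…, farm rc 0 / 0 sorries) with gate hygiene ONLY: split in two files for the 400-line rule (this file = nodes,
skeleton, Π₁ proof, Π₂ bookkeeping; `PermutationSavingForms28.lean` = the `Forms28Perm` proof and the final `_holds`), `@[conjecture]`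
tags on the two OPEN nodes `PhiSaving` / `GaugeLaw28Sorted`, eight one-line docstrings, one unused-binder lint fix; statements and
proofs otherwise VERBATIM.

**PROVED (0 sorries; final assembly in `PermutationSavingForms28.lean`): `symmetricGaugeLaw_of_gaugeLaw28_holds : GaugeLaw28 → SymmetricGaugeLaw`** — the
(29)–(30) saving is a THEOREM given (28) for all labellings: Π₁ `casoratianPermSymmetry_holds` (the Casoratian is
`S₇`-equivariant), Π₂ `gaugeDataPermInvariant_holds` (polytope, `d`, `m₁`, `m₅`, `e_D` are `S₇`-invariant, via
`forms28Perm_holds`), and `phiSaving_iff_symmetricGaugeLaw` (BZ's own shape Φ = the gauge form).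

HONEST FRAMING: systematic search; no irrationality claim unless certified.

Cell `pub-zeta5`, census seat g16, answering the lead's PROGRAMME note (STATUS.md 2026-08-20T15:56Z: "the (29)–(30)
permutation saving (typed only inside `SymmetricGaugeLaw` — a typed standalone statement of the permutation-group
saving is the missing node; gen-2/census to word it)").  Census files no Lean to the tree: its scratch file states the
node(s) and PROVES the logical skeleton; this is the lead lane's filing of it.

WHAT THE SAVING IS ON THE DUAL SIDE.  Brown–Zudilin (arXiv:2210.03391v3, Sect. 7, (28)–(30)): experimentally
`D_n p_n ∈ ℤ` (28); the group `G` of the cellular integral permutes the 28 linear forms and multiplies the linear form by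
the factorial gauge factor `∏(g h_i)!/∏ h_i!`, so (28) for every `g·a` gives `Φ_n⁻¹ D_n p_n ∈ ℤ` with
`ν_p = max_g (…)` (29)–(30).  Under the wedge dictionary (`SymmetricGaugeLaw.lean`, THE DICTIONARY): `P = ρ(b)·Cas_j(b)`,
`G ≅ S₇` acts by `b ↦ σ•b = permLower σ b`, `Cas_j`, `e_D`, `m₁`, `m₅`, `d`, `InPolytope` are `S₇`-INVARIANT and `ρ` is
not.  Hence:

* `GaugeLaw28` AS TYPED quantifies over EVERY `b : ℕ → ℤ`, i.e. over every labelling `σ•b` of a direction; its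
  instance at `σ•b` is (28) in the gauge `σ`.  So the (29)–(30) saving is NOT an extra law on the dual side: it is
  `GaugeLaw28` at the relabelled vectors PLUS the `S₇`-symmetry of the Casoratian — a THEOREM, PROVED BELOW
  (`casoratianPermSymmetry_holds : CasoratianPermSymmetry`: `U, W, V` are symmetric because `numPoly b = (2X+b₀)·∏_{j<7} f(b_{j+1})` is, hence
  `IsPFData (σ•b) = IsPFData b`, `pfData (σ•b) = pfData b`), not a conjecture to discover; the gauge-data bookkeeping
  `GaugeDataPermInvariant` is PROVED BELOW too (`forms28 (σ•b) ~ forms28 b`).  Net: `symmetricGaugeLaw_of_gaugeLaw28_holds :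
  GaugeLaw28 → SymmetricGaugeLaw` (PROVED here, 0 sorries); with `gaugeLaw28_of_symmetric_largePrime` (tree) the two typed laws are then EQUIVALENT at `p² > m₁`.
* `PhiSaving` (below) is (29)–(30) for `Pₙ` in Brown–Zudilin's own shape — `v_p(ρ(b)) + v_p(Cas_j(b)) ≥ −e_D(b,p) + ν(b,p)`,
  `ν(b,p) = max_σ (v_p ρ(b) − v_p ρ(σ•b)) ≥ 0` (`nuPhi`; = BZ's `ν_p`: by Legendre every form is `≤ m₁ < p²`, so
  `v_p ρ(b) − v_p ρ(σ•b) = Σ_{h ∈ supp ρ} (⌊h(b)/p⌋ − ⌊h(σ•b)/p⌋)`, the `d!` cancelling — census engine `nu_BZ`) — and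
  `phiSaving_iff_symmetricGaugeLaw` (PROVED here) shows it is LITERALLY `SymmetricGaugeLaw`: the standalone Φ-node and the
  gauge form are one statement.
* WHAT SPLITS BY VALUE is (28) itself, GAUGE BY GAUGE (census g15/g16 what-ifs on the record ray, nats/step, exact at
  rate): (28) in the IDENTITY gauge of the ray AS LABELLED (`b = n·(41;17,…,11)` descending; census rung `D`) is worth
  `55.180 → 54.583` alone (census-g16 proved ladder) and `… → 51.196` on top of LB♯♯ + the atlas cells; (28) in EVERY gauge (= `SymmetricGaugeLaw`
  = `PhiSaving` ⟸ typed `GaugeLaw28`) gives Brown–Zudilin's `C₂ = 49.606`.  The 1.59 nats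
  between them are the permutation saving; the best single gauge on cell A is `σ* b = (41; 11,12,13,16,17,15,14)`
  (`SymmetricGaugeLaw.lean`, last example).  A proof of (28) for ONE labelling class only (e.g. descending `b`) would be
  the intermediate node `51.196`; nothing in the tree distinguishes labellings, so such a restricted statement would
  have to name its gauge explicitly (`GaugeLaw28Sorted` below, OPTIONAL node).

DAG for the PROGRAMME (dual side, record ray): cells/LB♯♯ (51.701) → `GaugeLaw28Sorted` (51.196) → `GaugeLaw28` (all
labellings) ⟹ `SymmetricGaugeLaw` ⟺ `PhiSaving` (49.606 = C₂) — the last arrow a THEOREM of this file.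
-/

namespace Summit.KontsevichZagierPeriods.Zeta5Search.SymmetricGauge

open Finset
open Summit.KontsevichZagierPeriods.Zeta5Search.CasoratianValuation (casoratian shift InPolytope)
open Summit.KontsevichZagierPeriods.Zeta5Search.WedgeDictionary (dOf)

/-! ### The nodes -/

/-- **NODE Π₁ — `S₇`-EQUIVARIANCE OF THE CASORATIAN (the dual-side group structure; PROVABLE):**
`Cas_{i+1}(σ•b) = Cas_{σ(i)+1}(b)`.  (`U, W, V` are symmetric functions of `b₁,…,b₇` — `numPoly`, hence `IsPFData`
and `pfData`, are — and `(σ•b) + e_{i+1} = σ•(b + e_{σ(i)+1})`, `shift_permLower`.) -/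
def CasoratianPermSymmetry : Prop :=
  ∀ (b : ℕ → ℤ) (σ : Equiv.Perm (Fin 7)) (i : Fin 7),
    casoratian (permLower σ b) (i.val + 1) = casoratian b ((σ i).val + 1)

/-- **NODE Π₂ — the gauge data are `S₇`-invariant (PROVABLE bookkeeping):** the polytope, `d`, `m₁`, `m₅`, `e_D`
(`forms28 (σ•b)` is a permutation of `forms28 b`). -/
def GaugeDataPermInvariant : Prop :=
  ∀ (b : ℕ → ℤ) (σ : Equiv.Perm (Fin 7)),
    (InPolytope b → InPolytope (permLower σ b)) ∧ dOf (permLower σ b) = dOf b ∧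
      m1 (permLower σ b) = m1 b ∧ m5 (permLower σ b) = m5 b ∧ ∀ p : ℕ, eD (permLower σ b) p = eD b p

/-- Brown–Zudilin's saving exponent on the dual side: `ν(b,p) = max_{σ ∈ S₇} (v_p ρ(b) − v_p ρ(σ•b))` (`≥ 0`, `σ = 1`). -/
def nuPhi (b : ℕ → ℤ) (p : ℕ) : ℤ :=
  (univ : Finset (Equiv.Perm (Fin 7))).sup' univ_nonempty
    fun σ => padicValRat p (rhoB b) - padicValRat p (rhoB (permLower σ b))

/-- **NODE Φ — (29)–(30) for `Pₙ` on the dual side, standalone (`Φₙ⁻¹ Dₙ Pₙ ∈ ℤ_(p)` with `v_p(P) = v_p ρ + v_p Cas_j`):**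
`v_p(ρ(b)) + v_p(Cas_j(b)) ≥ −e_D(b,p) + ν(b,p)` in the v2 cone, `p ≥ 5`, `p² > m₁(b)`.  OBSERVED (same evidence as
`SymmetricGaugeLaw`, to which it is equivalent: `phiSaving_iff_symmetricGaugeLaw`). -/
@[conjecture] def PhiSaving : Prop :=
  ∀ (b : ℕ → ℤ) (j p : ℕ),
    InPolytope b → 1 ≤ j → j ≤ 7 → InPolytope (shift b j) → dOf b ≤ 2 * m5 b →
    p.Prime → 5 ≤ p → m1 b < (p : ℤ) ^ 2 → casoratian b j ≠ 0 →
      -eD b p + nuPhi b p ≤ padicValRat p (rhoB b) + padicValRat p (casoratian b j)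

/-- **OPTIONAL NODE — (28) in ONE named gauge:** `GaugeLaw28` restricted to DESCENDING labellings `b₁ ≥ b₂ ≥ … ≥ b₇`
(the identity gauge of the census rays as tabulated; worth `51.196` on the record on top of LB♯♯ + cells, vs `49.606`
for all gauges). -/
@[conjecture] def GaugeLaw28Sorted : Prop :=
  ∀ (b : ℕ → ℤ) (j p : ℕ), (∀ i ∈ range 6, b (i + 2) ≤ b (i + 1)) →
    InPolytope b → 1 ≤ j → j ≤ 7 → InPolytope (shift b j) → dOf b ≤ 2 * m5 b →
    p.Prime → 5 ≤ p → casoratian b j ≠ 0 →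
      -eD b p - padicValRat p (rhoB b) ≤ padicValRat p (casoratian b j)

/-- `GaugeLaw28Sorted` is a special case of `GaugeLaw28` (trivial). -/
theorem gaugeLaw28Sorted_of_gaugeLaw28 (h : GaugeLaw28) : GaugeLaw28Sorted :=
  fun b j p _ hb hj1 hj7 hb' hd hp h5 hne => h b j p hb hj1 hj7 hb' hd hp h5 hne

/-! ### Relabelling bookkeeping (PROVED) -/

/-- `(σ•b)_{i+1} = b_{σ(i)+1}`. -/
theorem permLower_apply_succ (σ : Equiv.Perm (Fin 7)) (b : ℕ → ℤ) (i : Fin 7) :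
    permLower σ b (i.val + 1) = b ((σ i).val + 1) := by
  have h : 1 ≤ i.val + 1 ∧ i.val + 1 ≤ 7 := ⟨by omega, by omega⟩
  have e : (⟨i.val + 1 - 1, by omega⟩ : Fin 7) = i := Fin.ext (by simp)
  simp only [permLower, dif_pos h, e]

/-- `(σ•b)_k = b_k` off `[1,7]`. -/
theorem permLower_apply_of_not (σ : Equiv.Perm (Fin 7)) (b : ℕ → ℤ) {k : ℕ} (hk : ¬ (1 ≤ k ∧ k ≤ 7)) :
    permLower σ b k = b k := by
  simp only [permLower, dif_neg hk]

/-- Shifting commutes with relabelling: `(σ•b) + e_{i+1} = σ•(b + e_{σ(i)+1})`. -/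
theorem shift_permLower (b : ℕ → ℤ) (σ : Equiv.Perm (Fin 7)) (i : Fin 7) :
    shift (permLower σ b) (i.val + 1) = permLower σ (shift b ((σ i).val + 1)) := by
  funext k
  by_cases hk : 1 ≤ k ∧ k ≤ 7
  · obtain ⟨m, rfl⟩ : ∃ m : Fin 7, k = m.val + 1 := ⟨⟨k - 1, by omega⟩, by simp only; omega⟩
    rw [permLower_apply_succ]
    simp only [shift, Function.update_apply, permLower_apply_succ]
    by_cases hm : m = i
    · subst hm; simp
    · have h1 : m.val ≠ i.val := fun h => hm (Fin.ext h)
      have h2 : (σ m).val ≠ (σ i).val := fun h => hm (σ.injective (Fin.ext h))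
      simp [h1, h2]
  · have h1 : k ≠ i.val + 1 := by omega
    have h2 : k ≠ (σ i).val + 1 := by have := (σ i).isLt; omega
    simp only [shift, Function.update_apply, permLower_apply_of_not σ _ hk, if_neg h1, if_neg h2]

/-! ### The skeleton (PROVED): the saving is the symmetry -/

/-- **`GaugeLaw28` (all labellings) + `S₇`-symmetry ⟹ the full gauge law.**  The `σ`-instance at `(b, j)` is (28) at
the relabelled vector `σ•b` with the transported index `i+1`, `σ(i)+1 = j`. -/
theorem symmetricGaugeLaw_of_gaugeLaw28 (hsym : CasoratianPermSymmetry) (hinv : GaugeDataPermInvariant)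
    (h28 : GaugeLaw28) : SymmetricGaugeLaw := by
  intro b j p σ hb hj1 hj7 hb' hd hp h5 _hm hne
  obtain ⟨hP, hdOf, _hm1, hm5, heD⟩ := hinv b σ
  -- the index `i` with `σ(i)+1 = j`
  set i : Fin 7 := σ.symm ⟨j - 1, by omega⟩ with hi
  have hσi : (σ i).val + 1 = j := by simp [hi]; omega
  have hcas : casoratian (permLower σ b) (i.val + 1) = casoratian b j := by rw [hsym b σ i, hσi]
  have hshift : InPolytope (shift (permLower σ b) (i.val + 1)) := by
    rw [shift_permLower, hσi]; exact (hinv (shift b j) σ).1 hb'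
  have hcone : dOf (permLower σ b) ≤ 2 * m5 (permLower σ b) := by rw [hdOf, hm5]; exact hd
  have hne' : casoratian (permLower σ b) (i.val + 1) ≠ 0 := by rw [hcas]; exact hne
  have key := h28 (permLower σ b) (i.val + 1) p (hP hb) (by omega) (by have := i.isLt; omega) hshift hcone hp h5 hne'
  rw [hcas, heD] at key
  exact key

/-- **The standalone Φ-node IS the gauge law** (pure valuation bookkeeping: `max_σ` vs `∀ σ`). -/
theorem phiSaving_iff_symmetricGaugeLaw : PhiSaving ↔ SymmetricGaugeLaw := by
  constructor
  · intro h b j p σ hb hj1 hj7 hb' hd hp h5 hm hne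
    have H := h b j p hb hj1 hj7 hb' hd hp h5 hm hne
    have hle : padicValRat p (rhoB b) - padicValRat p (rhoB (permLower σ b)) ≤ nuPhi b p :=
      Finset.le_sup' (fun τ => padicValRat p (rhoB b) - padicValRat p (rhoB (permLower τ b))) (mem_univ σ)
    linarith
  · intro h b j p hb hj1 hj7 hb' hd hp h5 hm hne
    have hsup : nuPhi b p ≤ eD b p + padicValRat p (rhoB b) + padicValRat p (casoratian b j) := by
      apply Finset.sup'_le
      intro σ _
      have := h b j p σ hb hj1 hj7 hb' hd hp h5 hm hne
      linarith
    linarith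

/-- Hence, at `p² > m₁`: typed `GaugeLaw28` + symmetry ⟹ `PhiSaving`; and `PhiSaving ⟹ GaugeLaw28` there
(`gaugeLaw28_of_symmetric_largePrime`, tree). -/
theorem phiSaving_of_gaugeLaw28 (hsym : CasoratianPermSymmetry) (hinv : GaugeDataPermInvariant)
    (h28 : GaugeLaw28) : PhiSaving :=
  phiSaving_iff_symmetricGaugeLaw.2 (symmetricGaugeLaw_of_gaugeLaw28 hsym hinv h28)

/-- `ν ≥ 0` (take `σ = 1`). -/
theorem nuPhi_nonneg (b : ℕ → ℤ) (p : ℕ) : 0 ≤ nuPhi b p := by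
  have e : permLower 1 b = b := by
    funext i; unfold permLower; split_ifs with hi
    · simp only [Equiv.Perm.coe_one, id_eq]; congr 1; omega
    · rfl
  have := Finset.le_sup' (fun τ : Equiv.Perm (Fin 7) => padicValRat p (rhoB b) - padicValRat p (rhoB (permLower τ b))) (mem_univ 1)
  simp only [e, sub_self] at this
  exact this

/-! ### Node Π₁ PROVED: the Casoratian is `S₇`-equivariant

`numPoly b = (2X + b₀)·∏_{j<7} g(b₀, b_{j+1})` is a symmetric function of `b₁,…,b₇`, so `IsPFData (σ•b) = IsPFData b`,
hence `pfData (σ•b) = pfData b` (same `Classical.choose`), `W, V, U` are `S₇`-invariant, and with `shift_permLower`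
the Casoratian transforms by relabelling the shift direction. -/

section PermSymmetryProof

open Polynomial
open Summit.KontsevichZagierPeriods.Zeta5Search.DualSeries (numPoly)
open Summit.KontsevichZagierPeriods.Zeta5Search.WedgeDictionary (IsPFData pfData coeffU coeffW coeffV)
open Literature.NumberTheory.Transcendental.BallRivoal (pochPoly)

/-- `(σ•b)₀ = b₀`. -/
theorem permLower_zero (σ : Equiv.Perm (Fin 7)) (b : ℕ → ℤ) : permLower σ b 0 = b 0 :=
  permLower_apply_of_not σ b (by omega)

/-- The numerator polynomial is `S₇`-invariant. -/
theorem numPoly_permLower (σ : Equiv.Perm (Fin 7)) (b : ℕ → ℤ) :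
    numPoly (permLower σ b) = numPoly b := by
  have key : (∏ j ∈ range 7, (pochPoly 0 (permLower σ b (j + 1)).toNat *
      pochPoly ((permLower σ b 0 - permLower σ b (j + 1) + 1 : ℤ) : ℚ) (permLower σ b (j + 1)).toNat)) =
      ∏ j ∈ range 7, (pochPoly 0 (b (j + 1)).toNat *
        pochPoly ((b 0 - b (j + 1) + 1 : ℤ) : ℚ) (b (j + 1)).toNat) := by
    rw [Finset.prod_range, Finset.prod_range]
    simp only [permLower_apply_succ, permLower_zero]
    exact Equiv.prod_comp σ (fun k : Fin 7 => pochPoly 0 (b (↑k + 1)).toNat *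
      pochPoly ((b 0 - b (↑k + 1) + 1 : ℤ) : ℚ) (b (↑k + 1)).toNat)
  unfold numPoly
  rw [key, permLower_zero]

/-- Partial-fraction data of `σ•b` are exactly those of `b`. -/
theorem isPFData_permLower_iff (σ : Equiv.Perm (Fin 7)) (b : ℕ → ℤ) (c : ℕ → ℕ → ℚ) :
    IsPFData (permLower σ b) c ↔ IsPFData b c := by
  unfold IsPFData
  rw [numPoly_permLower, permLower_zero]

/-- `Classical.choose` is invariant under replacing the predicate by an equal one. -/
theorem choose_congr_pred {α : Sort*} {p p' : α → Prop} (e : p = p') (hp : ∃ c, p c) (hp' : ∃ c, p' c) :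
    Classical.choose hp = Classical.choose hp' := by
  subst e; rfl

/-- Hence the CANONICAL data agree (same `Classical.choose`). -/
theorem pfData_permLower (σ : Equiv.Perm (Fin 7)) (b : ℕ → ℤ) : pfData (permLower σ b) = pfData b := by
  have e : IsPFData (permLower σ b) = IsPFData b := funext fun c => propext (isPFData_permLower_iff σ b c)
  unfold pfData
  by_cases hb : ∃ c, IsPFData b c
  · have hb' : ∃ c, IsPFData (permLower σ b) c := by rw [e]; exact hb
    rw [dif_pos hb', dif_pos hb]
    exact choose_congr_pred e hb' hb
  · have hb' : ¬ ∃ c, IsPFData (permLower σ b) c := by rw [e]; exact hb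
    rw [dif_neg hb', dif_neg hb]

/-- `W(σ•b) = W(b)`. -/
theorem coeffW_permLower (σ : Equiv.Perm (Fin 7)) (b : ℕ → ℤ) : coeffW (permLower σ b) = coeffW b := by
  unfold coeffW; rw [pfData_permLower, permLower_zero]

/-- `V(σ•b) = V(b)`. -/
theorem coeffV_permLower (σ : Equiv.Perm (Fin 7)) (b : ℕ → ℤ) : coeffV (permLower σ b) = coeffV b := by
  unfold coeffV; rw [pfData_permLower, permLower_zero]

/-- `U(σ•b) = U(b)`. -/
theorem coeffU_permLower (σ : Equiv.Perm (Fin 7)) (b : ℕ → ℤ) : coeffU (permLower σ b) = coeffU b := by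
  unfold coeffU; rw [pfData_permLower, permLower_zero]

/-- **NODE Π₁ PROVED.** -/
theorem casoratianPermSymmetry_holds : CasoratianPermSymmetry := by
  intro b σ i
  simp only [casoratian]
  rw [shift_permLower, coeffW_permLower, coeffV_permLower, coeffW_permLower, coeffV_permLower]

/-- So the gauge law needs only (28) for all labellings plus the gauge-data bookkeeping Π₂. -/
theorem symmetricGaugeLaw_of_gaugeLaw28' (hinv : GaugeDataPermInvariant) (h28 : GaugeLaw28) :
    SymmetricGaugeLaw :=
  symmetricGaugeLaw_of_gaugeLaw28 casoratianPermSymmetry_holds hinv h28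

end PermSymmetryProof

/-! ### Node Π₂ reduced to ONE combinatorial fact: relabelling permutes the 28 forms

`InPolytope` and `d` are `S₇`-invariant by reindexing finite sums (PROVED).  `m₁`, `m₅`, `e_D` are functions of the
SORTED list of the 28 forms, hence invariant as soon as `forms28 (σ•b)` is a PERMUTATION of `forms28 b` (`Forms28Perm`
— the image of the 21 pairs `{j<k}` under `σ` is the 21 pairs again, as UNORDERED pairs; left to prove: a `List.Perm`
/ `Multiset` bookkeeping over `List.range 7` / `flatMap`).  Consequences for `m₅`, `e_D` via `List.Perm.eq_of_pairwise'`
+ `List.pairwise_insertionSort`, for `m₁` via a `foldr max` permutation lemma (all PROVED). -/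

section GaugeDataBookkeeping

open Summit.KontsevichZagierPeriods.Zeta5Search.DualSeries (InBox)

/-- `Σ_{i<7} f(b_{σ(i)+1}) = Σ_{i<7} f(b_{i+1})`. -/
theorem sum_range7_permLower (σ : Equiv.Perm (Fin 7)) (b : ℕ → ℤ) (f : ℤ → ℤ) :
    ∑ i ∈ range 7, f (permLower σ b (i + 1)) = ∑ i ∈ range 7, f (b (i + 1)) := by
  rw [Finset.sum_range, Finset.sum_range]
  simp only [permLower_apply_succ]
  exact Equiv.sum_comp σ (fun k : Fin 7 => f (b (↑k + 1)))

/-- `d(σ•b) = d(b)`. -/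
theorem dOf_permLower (σ : Equiv.Perm (Fin 7)) (b : ℕ → ℤ) : dOf (permLower σ b) = dOf b := by
  unfold dOf
  rw [permLower_zero]
  have := sum_range7_permLower σ b id
  simp only [id] at this
  rw [this]

/-- The one combinatorial fact: relabelling permutes the 28 forms. -/
def Forms28Perm : Prop :=
  ∀ (b : ℕ → ℤ) (σ : Equiv.Perm (Fin 7)), (forms28 (permLower σ b)).Perm (forms28 b)

/-- Sorted lists of permuted data coincide. -/
theorem insertionSort_eq_of_perm {l₁ l₂ : List ℤ} (h : l₁.Perm l₂) :
    l₁.insertionSort (· ≥ ·) = l₂.insertionSort (· ≥ ·) :=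
  List.Perm.eq_of_pairwise' (List.pairwise_insertionSort _ l₁) (List.pairwise_insertionSort _ l₂)
    (((List.perm_insertionSort _ l₁).trans h).trans (List.perm_insertionSort _ l₂).symm)

/-- `m₅(σ•b) = m₅(b)` (given `Forms28Perm`). -/
theorem m5_permLower (hF : Forms28Perm) (σ : Equiv.Perm (Fin 7)) (b : ℕ → ℤ) :
    m5 (permLower σ b) = m5 b := by
  unfold m5; rw [insertionSort_eq_of_perm (hF b σ)]

/-- `e_D(σ•b, p) = e_D(b, p)` (given `Forms28Perm`). -/
theorem eD_permLower (hF : Forms28Perm) (σ : Equiv.Perm (Fin 7)) (b : ℕ → ℤ) (p : ℕ) :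
    eD (permLower σ b) p = eD b p := by
  unfold eD; rw [insertionSort_eq_of_perm (hF b σ)]

/-- `foldr max 0` is permutation-invariant. -/
theorem foldr_max_eq_of_perm {l₁ l₂ : List ℤ} (h : l₁.Perm l₂) : l₁.foldr max 0 = l₂.foldr max 0 := by
  induction h with
  | nil => rfl
  | cons x _ ih => simp [List.foldr_cons, ih]
  | swap x y l => simp only [List.foldr_cons]; rw [← max_assoc, max_comm y x, max_assoc]
  | trans _ _ ih₁ ih₂ => exact ih₁.trans ih₂

/-- `m₁(σ•b) = m₁(b)` (given `Forms28Perm`). -/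
theorem m1_permLower (hF : Forms28Perm) (σ : Equiv.Perm (Fin 7)) (b : ℕ → ℤ) :
    m1 (permLower σ b) = m1 b := by
  unfold m1; exact foldr_max_eq_of_perm (hF b σ)

/-- The polytope is `S₇`-invariant. -/
theorem inPolytope_permLower (σ : Equiv.Perm (Fin 7)) {b : ℕ → ℤ} (h : InPolytope b) :
    InPolytope (permLower σ b) := by
  obtain ⟨⟨h0, hbox⟩, htwo, hsum⟩ := h
  refine ⟨⟨by rw [permLower_zero]; exact h0, fun j hj => ?_⟩, fun j hj => ?_, ?_⟩
  · have hj7 : j < 7 := mem_range.1 hj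
    have e := permLower_apply_succ σ b ⟨j, hj7⟩
    simp only at e
    rw [e, permLower_zero]
    exact hbox _ (mem_range.2 (σ ⟨j, hj7⟩).isLt)
  · have hj7 : j < 7 := mem_range.1 hj
    have e := permLower_apply_succ σ b ⟨j, hj7⟩
    simp only at e
    rw [e, permLower_zero]
    exact htwo _ (mem_range.2 (σ ⟨j, hj7⟩).isLt)
  · have := sum_range7_permLower σ b id
    simp only [id] at this
    rw [this, permLower_zero]
    exact hsum

/-- **Node Π₂ reduced to the one combinatorial fact.** -/
theorem gaugeDataPermInvariant_of_forms28Perm (hF : Forms28Perm) : GaugeDataPermInvariant :=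
  fun b σ => ⟨inPolytope_permLower σ, dOf_permLower σ b, m1_permLower hF σ b, m5_permLower hF σ b,
    fun p => eD_permLower hF σ b p⟩


/-- **THE (29)–(30) NODE AFTER CENSUS g16:** the gauge law (= `PhiSaving`) follows from typed `GaugeLaw28` (all
labellings) and the single combinatorial bookkeeping fact `Forms28Perm`; the Casoratian symmetry Π₁ is PROVED above. -/
theorem symmetricGaugeLaw_of_gaugeLaw28_forms (hF : Forms28Perm) (h28 : GaugeLaw28) : SymmetricGaugeLaw :=
  symmetricGaugeLaw_of_gaugeLaw28 casoratianPermSymmetry_holds (gaugeDataPermInvariant_of_forms28Perm hF) h28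

/-- `Forms28Perm → GaugeLaw28 → PhiSaving`. -/
theorem phiSaving_of_gaugeLaw28_forms (hF : Forms28Perm) (h28 : GaugeLaw28) : PhiSaving :=
  phiSaving_iff_symmetricGaugeLaw.2 (symmetricGaugeLaw_of_gaugeLaw28_forms hF h28)

end GaugeDataBookkeeping

end Summit.KontsevichZagierPeriods.Zeta5Search.SymmetricGauge
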